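import Summits.QuantumFields.YangMills.Theorems.ColdStartUniversalityColdStartSolutionsExistFlatFiltration
import Literature.Analysis.FunctionSpaces.ItoProcessesProofs
import Literature.Probability.Process.ItoIntegralCore
import Literature.MathematicalPhysics.QuantumLattice.RepLieAlgebraUnitary
import HarnessLib

/-!
# Route `ColdStartUniversality` (rung input (E1) of crux K_A1, stmt-QuantumFields-24809): transport of
# lattice Langevin solutions along a factor map of the driving noise

Helper file (seat `ym-line-csu-p1`).  Toward (E1) «uniqueness in law of cold-start solutions» (crux workfile
`Cruxes/UniformColdStartMixing/Lines/rung_fixedCutoffMixing.lean` v3, stub `hyp_lawUnique`).  Setting: two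
probability spaces `(Ω, P)`, `(Ωc, Pc)` with flat Brownian motions `W`, `Wc` and a measurable map
`φ : Ω → Ωc` with `P ∘ φ⁻¹ = Pc` and `W_t = Wc_t ∘ φ` (the case in point: `φ` = the path map of `W`, `Ωc` = path
space).  Main result `isSolution_comp`: if `Uc` solves the SU(2) Shen–Zhu–Zhu system on `(Ωc, Pc, Wc)` (raw
natural filtration), then `Uc ∘ φ` solves it on `(Ω, P, W)`.  With pathwise uniqueness
(`latticeLangevin_pathwise_unique`) this makes every solution on `Ω` a.s. equal to the canonical one read
along `W`, whence uniqueness in law.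

The proof never transports the local-martingale clause of the tree's characterised Itô integral: the
stochastic integrals of the pulled-back solution are CONSTRUCTED on `Ω` (`exists_isItoIntegral_flatCoord`, after
dyadic regularisation of the bounded continuous adapted integrands) and then IDENTIFIED with the pulled-back
canonical integrals through one pulled-back approximating sequence of simple processes and the a.s. uniqueness
of u.c.p. limits (`TendstoUCP.ae_eq`); probabilities of pre-images are bounded by `Pc` (`le_map_apply`), which
is the direction both transports need.

* `tendstoUCP_comp`, `SimpleProcess.exists_comp`, `isApproxSeq_comp` — pull-backs along `φ`;
* `itoIntegral_ae_eq_comp` — an Itô integral on `Ω` of the pulled-back integrand against the pulled-back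
  integrator equals the pulled-back Itô integral a.s.;
* `comap_natFiltration_le` — `φ⁻¹(𝓕^{Wc}_t) ≤ 𝓕^{W}_t`;
* `exists_isItoIntegral_comp` — construction + identification for one bounded continuous coefficient;
* `isSolution_comp` — the transport of `LinkSDE.IsSolution`.

No definition, no sorry.  RECORD-rung R3 plumbing (Revuz–Yor IX §1 «solutions as functionals of the driving
Brownian motion»); nothing here bears on the mass gap. -/

set_option autoImplicit false

noncomputable section

namespace Summit.QuantumFields.YangMills.Theorems.ColdStartUniversality

open MeasureTheory ProbabilityTheory Filter Topology
open scoped NNReal ENNReal BigOperators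
open Literature.Probability.Process Literature.Analysis.FunctionSpaces
open Literature.MathematicalPhysics.QuantumFieldTheory
open Literature.MathematicalPhysics.QuantumLattice (fundamentalRep fundamentalLatticeRep continuous_fundamentalRep)

section Generic

variable {Ω Ωc : Type*} {mΩ : MeasurableSpace Ω} {mΩc : MeasurableSpace Ωc} {P : Measure Ω} {Pc : Measure Ωc}
  {φ : Ω → Ωc}

/-- Pre-images under a factor map have probability at most the image probability (outer measures; equality on
measurable sets). [folklore] -/
theorem measure_preimage_le_of_map_eq (hφ : Measurable φ) (hmap : P.map φ = Pc) (A : Set Ωc) :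
    P (φ ⁻¹' A) ≤ Pc A := by
  rw [← hmap]
  exact Measure.le_map_apply hφ.aemeasurable A

/-- u.c.p. convergence pulls back along a factor map. [folklore] -/
theorem tendstoUCP_comp (hφ : Measurable φ) (hmap : P.map φ = Pc) {Y : ℕ → ℝ≥0 → Ωc → ℝ}
    {J : ℝ≥0 → Ωc → ℝ} (h : TendstoUCP Y J Pc) :
    TendstoUCP (fun n t ω => Y n t (φ ω)) (fun t ω => J t (φ ω)) P := by
  intro t ε hε
  refine tendsto_of_tendsto_of_tendsto_of_le_of_le tendsto_const_nhds (h t ε hε) (fun n => bot_le)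
    fun n => ?_
  exact measure_preimage_le_of_map_eq hφ hmap {y | ∃ s ≤ t, ε ≤ |Y n s y - J s y|}

/-- A simple process for `𝓕c` pulls back along `φ` to a simple process for any filtration `𝓕` on `Ω`
containing `φ⁻¹ 𝓕c`, with pulled-back step process and elementary integrals. [folklore] -/
theorem SimpleProcess.exists_comp {𝓕 : Filtration ℝ≥0 mΩ} {𝓕c : Filtration ℝ≥0 mΩc}
    (h𝓕 : ∀ t, (𝓕c t).comap φ ≤ 𝓕 t) (K : SimpleProcess mΩc 𝓕c) :
    ∃ K' : SimpleProcess mΩ 𝓕, (∀ t ω, K'.toProcess t ω = K.toProcess t (φ ω)) ∧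
      ∀ (B : ℝ≥0 → Ωc → ℝ) (t : ℝ≥0) (ω : Ω), K'.integral (fun t ω => B t (φ ω)) t ω = K.integral B t (φ ω) := by
  obtain ⟨C, hC⟩ := K.bounded
  have hmeas : ∀ i, ∀ h : i < K.times.length,
      StronglyMeasurable[𝓕 (K.times.get ⟨i, h⟩)] (fun ω => K.value i (φ ω)) := by
    intro i hi
    have hm : Measurable[𝓕c (K.times.get ⟨i, hi⟩)] (K.value i) := (K.measurable i hi).measurable
    have hφ' : Measurable[(𝓕c (K.times.get ⟨i, hi⟩)).comap φ, 𝓕c (K.times.get ⟨i, hi⟩)] φ :=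
      measurable_iff_comap_le.2 le_rfl
    exact ((hm.comp hφ').mono (h𝓕 _) le_rfl).stronglyMeasurable
  exact ⟨⟨K.times, K.sorted, fun i ω => K.value i (φ ω), hmeas, ⟨C, fun i ω => hC i (φ ω)⟩⟩,
    fun t ω => rfl, fun B t ω => rfl⟩

/-- Approximating sequences pull back along a factor map. [folklore] -/
theorem isApproxSeq_comp (hφ : Measurable φ) (hmap : P.map φ = Pc) {𝓕 : Filtration ℝ≥0 mΩ}
    {𝓕c : Filtration ℝ≥0 mΩc} {Kn : ℕ → SimpleProcess mΩc 𝓕c} {K'n : ℕ → SimpleProcess mΩ 𝓕}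
    (hK : ∀ n t ω, (K'n n).toProcess t ω = (Kn n).toProcess t (φ ω)) {H : ℝ≥0 → Ωc → ℝ}
    (h : SimpleProcess.IsApproxSeq Kn H Pc) :
    SimpleProcess.IsApproxSeq K'n (fun t ω => H t (φ ω)) P := by
  intro t ε hε
  refine tendsto_of_tendsto_of_tendsto_of_le_of_le tendsto_const_nhds (h t ε hε) (fun n => bot_le)
    fun n => ?_
  simp only [hK]
  exact measure_preimage_le_of_map_eq hφ hmap _

/-- **Identification of a pulled-back Itô integral.**  If `Jc = ∫ Hc dBc` on `(Ωc, 𝓕c, Pc)` and `J` is an Itô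
integral on `(Ω, 𝓕, P)` of an integrand a.s. equal to `Hc ∘ φ` against `Bc ∘ φ` (`φ⁻¹ 𝓕c ≤ 𝓕`, `P ∘ φ⁻¹ = Pc`),
then `J = Jc ∘ φ` a.s.: both are u.c.p. limits of the elementary integrals along one pulled-back approximating
sequence. [folklore] -/
theorem itoIntegral_ae_eq_comp (hφ : Measurable φ) (hmap : P.map φ = Pc) {𝓕 : Filtration ℝ≥0 mΩ}
    {𝓕c : Filtration ℝ≥0 mΩc} (h𝓕 : ∀ t, (𝓕c t).comap φ ≤ 𝓕 t) {Hc Bc Jc : ℝ≥0 → Ωc → ℝ}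
    (hJc : IsItoIntegral Hc Bc Jc 𝓕c Pc) {H J : ℝ≥0 → Ω → ℝ} (hH : ∀ᵐ ω ∂P, ∀ t, H t ω = Hc t (φ ω))
    (hJ : IsItoIntegral H (fun t ω => Bc t (φ ω)) J 𝓕 P) :
    ∀ᵐ ω ∂P, ∀ t, J t ω = Jc t (φ ω) := by
  obtain ⟨Kn, hKn⟩ := hJc.2.2.2.1
  have hucp := hJc.2.2.2.2 Kn hKn
  choose K'n hK'1 hK'2 using fun n => SimpleProcess.exists_comp (𝓕 := 𝓕) h𝓕 (Kn n)
  have happ : SimpleProcess.IsApproxSeq K'n (fun t ω => Hc t (φ ω)) P :=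
    isApproxSeq_comp hφ hmap (fun n => hK'1 n) hKn
  have happ' : SimpleProcess.IsApproxSeq K'n H P := (SimpleProcess.isApproxSeq_congr_ae hH).2 happ
  have h1 : TendstoUCP (fun n => (K'n n).integral (fun t ω => Bc t (φ ω))) J P := hJ.2.2.2.2 K'n happ'
  have h2 : TendstoUCP (fun n => (K'n n).integral (fun t ω => Bc t (φ ω))) (fun t ω => Jc t (φ ω)) P := by
    have h := tendstoUCP_comp hφ hmap hucp
    have heq : (fun n (t : ℝ≥0) ω => (Kn n).integral Bc t (φ ω)) =
        fun n => (K'n n).integral (fun t ω => Bc t (φ ω)) := by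
      funext n t ω
      exact (hK'2 n Bc t ω).symm
    rw [heq] at h
    exact h
  exact TendstoUCP.ae_eq h1 h2

/-- A bounded-a.s. integrand has finite `L²(ds ⊗ P)` energy on every `[0, t]`. [folklore] -/
theorem sqErr_zero_ne_top_of_ae_abs_le [IsFiniteMeasure P] {H : ℝ≥0 → Ω → ℝ} {C : ℝ}
    (hC : ∀ᵐ ω ∂P, ∀ s, |H s ω| ≤ C) (t : ℝ≥0) : sqErr H 0 P t ≠ ⊤ := by
  rw [sqErr]
  have hle : ∀ᵐ ω ∂P, (∫⁻ s in Set.Icc (0 : ℝ) t, ENNReal.ofReal ((H s.toNNReal ω - (0 : ℝ≥0 → Ω → ℝ) s.toNNReal ω) ^ 2))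
      ≤ ENNReal.ofReal (C ^ 2) * volume (Set.Icc (0 : ℝ) t) := by
    filter_upwards [hC] with ω hω
    rw [← setLIntegral_const]
    refine setLIntegral_mono' measurableSet_Icc fun s _ => ?_
    refine ENNReal.ofReal_le_ofReal ?_
    simp only [Pi.zero_apply, sub_zero]
    have h1 := hω s.toNNReal
    rw [← sq_abs]
    exact pow_le_pow_left₀ (abs_nonneg _) h1 2
  refine ne_top_of_le_ne_top ?_ (lintegral_mono_ae hle |>.trans (le_of_eq (lintegral_const _)))
  exact ENNReal.mul_ne_top (ENNReal.mul_ne_top ENNReal.ofReal_ne_top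
    (by rw [Real.volume_Icc]; exact ENNReal.ofReal_ne_top)) (measure_ne_top _ _)

end Generic

/-! ### Flat Brownian motions related by a factor map -/

section Flat

variable {Ω Ωc : Type*} {mΩ : MeasurableSpace Ω} {mΩc : MeasurableSpace Ωc} {P : Measure Ω} {Pc : Measure Ωc}
  {φ : Ω → Ωc} {L : ℕ} [NeZero L]
  {W : ℝ≥0 → Ω → (Edge 3 L × NoiseIdx 2 → ℝ)} {Wc : ℝ≥0 → Ωc → (Edge 3 L × NoiseIdx 2 → ℝ)}

/-- `φ⁻¹ σ(Wc_s : s ≤ t) ≤ σ(W_s : s ≤ t)` when `W = Wc ∘ φ` (in fact equality). [folklore] -/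
theorem comap_natFiltration_le (hW : IsFlatBrownian W P) (hWc : IsFlatBrownian Wc Pc)
    (hWφ : ∀ t ω, W t ω = Wc t (φ ω)) (t : ℝ≥0) :
    (hWc.natFiltration t).comap φ ≤ hW.natFiltration t := by
  change MeasurableSpace.comap φ (⨆ j ≤ t, MeasurableSpace.comap (Wc j) inferInstance) ≤
    ⨆ j ≤ t, MeasurableSpace.comap (W j) inferInstance
  rw [MeasurableSpace.comap_iSup]
  refine iSup_le fun j => ?_
  rw [MeasurableSpace.comap_iSup]
  refine iSup_le fun hj => ?_
  rw [MeasurableSpace.comap_comp]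
  have hWj : Wc j ∘ φ = W j := funext fun ω => (hWφ j ω).symm
  rw [hWj]
  exact le_iSup₂_of_le j hj le_rfl

/-- **Construction + identification of one transported stochastic integral.**  For a continuous real
coefficient `g` on the compact configuration space, a process `Uc` on `Ωc` adapted to `𝓕^{Wc}` with a.s.
continuous paths and an Itô integral `Jc = ∫ g(Uc) dWc^k`, there is on `Ω` an Itô integral
`J' = ∫ g(Uc ∘ φ) dW^k` w.r.t. `𝓕^W`, and `J' = Jc ∘ φ` a.s. [folklore] -/
theorem exists_isItoIntegral_comp [IsProbabilityMeasure P] [IsProbabilityMeasure Pc]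
    (hW : IsFlatBrownian W P) (hWc : IsFlatBrownian Wc Pc) (hφ : Measurable φ) (hmap : P.map φ = Pc)
    (hWφ : ∀ t ω, W t ω = Wc t (φ ω))
    {g : GaugeConfig 3 L (Matrix.specialUnitaryGroup (Fin 2) ℂ) → ℝ} (hg : Continuous g) (k : Edge 3 L × NoiseIdx 2)
    {Uc : ℝ≥0 → Ωc → GaugeConfig 3 L (Matrix.specialUnitaryGroup (Fin 2) ℂ)}
    (hUa : ∀ t, Measurable[hWc.natFiltration t] (Uc t)) (hUcont : ∀ᵐ p ∂Pc, Continuous fun t => Uc t p)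
    {Jc : ℝ≥0 → Ωc → ℝ}
    (hJc : IsItoIntegral (fun t p => g (Uc t p)) (fun t p => Wc t p k) Jc hWc.natFiltration Pc) :
    ∃ J' : ℝ≥0 → Ω → ℝ, IsItoIntegral (fun t ω => g (Uc t (φ ω))) (fun t ω => W t ω k) J' hW.natFiltration P ∧
      ∀ᵐ ω ∂P, ∀ t, J' t ω = Jc t (φ ω) := by
  have h𝓕 := comap_natFiltration_le hW hWc hWφ
  -- the pulled-back integrand: adapted, a.s. continuous, bounded
  set H : ℝ≥0 → Ω → ℝ := fun t ω => g (Uc t (φ ω)) with hHdef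
  have hHa : Adapted hW.natFiltration H := by
    intro t
    have hφ' : Measurable[(hWc.natFiltration t).comap φ, hWc.natFiltration t] φ :=
      measurable_iff_comap_le.2 le_rfl
    exact hg.measurable.comp (((hUa t).comp hφ').mono (h𝓕 t) le_rfl)
  have hHc : ∀ᵐ ω ∂P, Continuous fun t => H t ω := by
    have h1 : ∀ᵐ p ∂(P.map φ), Continuous fun t => Uc t p := by rw [hmap]; exact hUcont
    filter_upwards [ae_of_ae_map hφ.aemeasurable h1] with ω hω
    exact hg.comp hω
  obtain ⟨x₀, -, hx₀⟩ := isCompact_univ.exists_isMaxOn Set.univ_nonempty (hg.abs.continuousOn)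
  have hHb : ∀ ω s, |H s ω| ≤ |g x₀| := fun ω s => hx₀ (Set.mem_univ _)
  -- progressive version
  have hRp : IsStronglyProgressive hW.natFiltration (dyadicReg H) := isStronglyProgressive_dyadicReg hHa
  have hRH : ∀ᵐ ω ∂P, ∀ t, dyadicReg H t ω = H t ω := by
    filter_upwards [hHc] with ω hω t
    exact dyadicReg_apply_of_continuous hω t
  have hfin : ∀ t : ℝ≥0, sqErr (dyadicReg H) 0 P t ≠ ⊤ := fun t => by
    refine sqErr_zero_ne_top_of_ae_abs_le (C := |g x₀|) ?_ t
    filter_upwards [hRH] with ω hω s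
    rw [hω s]
    exact hHb ω s
  obtain ⟨J', hJ', -, -⟩ := exists_isItoIntegral_flatCoord hW k hRp hfin
  have hJ'H : IsItoIntegral H (fun t ω => W t ω k) J' hW.natFiltration P := hJ'.congr_integrand_ae hRH
  refine ⟨J', hJ'H, ?_⟩
  -- identification with the pulled-back integral
  have hB : (fun (t : ℝ≥0) ω => W t ω k) = fun t ω => (fun t p => Wc t p k) t (φ ω) := by
    funext t ω; simp only [hWφ t ω]
  rw [hB] at hJ'H
  exact itoIntegral_ae_eq_comp hφ hmap h𝓕 hJc (Eventually.of_forall fun ω t => rfl) hJ'H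

omit [NeZero L] in
/-- The SZZ noise coefficient entry `(σ_{e,n}(ρ ∘ V))_{ij}` is a continuous function of the configuration.
[folklore] -/
theorem continuous_noise_entry (β : ℝ) (e : Edge 3 L) (n : NoiseIdx 2) (i j : Fin 2) :
    Continuous (fun V : GaugeConfig 3 L (Matrix.specialUnitaryGroup (Fin 2) ℂ) =>
      (latticeLangevinDynamics (fundamentalLatticeRep 2) β).noise (matrixConfig (fundamentalRep (Fin 2)) V) e n i j) := by
  have hQ : Continuous fun V : GaugeConfig 3 L (Matrix.specialUnitaryGroup (Fin 2) ℂ) =>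
      (matrixConfig (fundamentalRep (Fin 2)) V) e := by
    show Continuous fun V : GaugeConfig 3 L (Matrix.specialUnitaryGroup (Fin 2) ℂ) => fundamentalRep (Fin 2) (V e)
    exact (continuous_fundamentalRep (Fin 2)).comp (continuous_apply e)
  have hN : Continuous fun V : GaugeConfig 3 L (Matrix.specialUnitaryGroup (Fin 2) ℂ) =>
      (latticeLangevinDynamics (fundamentalLatticeRep 2) β).noise (matrixConfig (fundamentalRep (Fin 2)) V) e n := by
    simp only [latticeLangevinDynamics_noise]
    exact (continuous_const.mul hQ).const_smul ((Real.sqrt 2 : ℝ) : ℂ)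
  exact ((continuous_apply j).comp (continuous_apply i)).comp hN

/-- **Transport of solutions along a factor map of the noise.**  If `φ : Ω → Ωc` is measurable with
`P ∘ φ⁻¹ = Pc` and `W_t = Wc_t ∘ φ` for flat Brownian motions `W`, `Wc`, and `Uc` solves the SU(2) SZZ system on
`(Ωc, Pc, Wc)` (raw natural filtration of `Wc`), then `Uc ∘ φ` solves it on `(Ω, P, W)` (raw natural filtration
of `W`). [folklore] -/
theorem isSolution_comp [IsProbabilityMeasure P] [IsProbabilityMeasure Pc]
    (hW : IsFlatBrownian W P) (hWc : IsFlatBrownian Wc Pc) (hφ : Measurable φ) (hmap : P.map φ = Pc)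
    (hWφ : ∀ t ω, W t ω = Wc t (φ ω)) (β : ℝ)
    {Uc : ℝ≥0 → Ωc → GaugeConfig 3 L (Matrix.specialUnitaryGroup (Fin 2) ℂ)}
    (hUc : (latticeLangevinDynamics (fundamentalLatticeRep 2) β).IsSolution (fundamentalRep (Fin 2))
      hWc.natFiltration Pc Wc Uc) :
    (latticeLangevinDynamics (fundamentalLatticeRep 2) β).IsSolution (fundamentalRep (Fin 2))
      hW.natFiltration P W (fun t ω => Uc t (φ ω)) := by
  classical
  have h𝓕 := comap_natFiltration_le hW hWc hWφ
  have hcont : ∀ᵐ ω ∂P, Continuous fun t => Uc t (φ ω) := by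
    have h1 : ∀ᵐ p ∂(P.map φ), Continuous fun t => Uc t p := by rw [hmap]; exact hUc.continuous
    exact ae_of_ae_map hφ.aemeasurable h1
  obtain ⟨Jc, hJc, hUceq⟩ := hUc.exists_ito
  -- transported real and imaginary parts of the stochastic integrals
  have hre : ∀ (e : Edge 3 L) (n : NoiseIdx 2) (i j : Fin 2), ∃ J' : ℝ≥0 → Ω → ℝ,
      IsItoIntegral (fun t ω => ((latticeLangevinDynamics (fundamentalLatticeRep 2) β).noise
          (matrixConfig (fundamentalRep (Fin 2)) (Uc t (φ ω))) e n i j).re) (fun t ω => W t ω (e, n)) J'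
        hW.natFiltration P ∧ ∀ᵐ ω ∂P, ∀ t, J' t ω = (Jc e n i j t (φ ω)).re := fun e n i j =>
    exists_isItoIntegral_comp hW hWc hφ hmap hWφ
      (g := fun V => ((latticeLangevinDynamics (fundamentalLatticeRep 2) β).noise
        (matrixConfig (fundamentalRep (Fin 2)) V) e n i j).re)
      (Complex.continuous_re.comp (continuous_noise_entry β e n i j)) (e, n) hUc.adapted hUc.continuous
      (hJc e n i j).1
  have him : ∀ (e : Edge 3 L) (n : NoiseIdx 2) (i j : Fin 2), ∃ J' : ℝ≥0 → Ω → ℝ,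
      IsItoIntegral (fun t ω => ((latticeLangevinDynamics (fundamentalLatticeRep 2) β).noise
          (matrixConfig (fundamentalRep (Fin 2)) (Uc t (φ ω))) e n i j).im) (fun t ω => W t ω (e, n)) J'
        hW.natFiltration P ∧ ∀ᵐ ω ∂P, ∀ t, J' t ω = (Jc e n i j t (φ ω)).im := fun e n i j =>
    exists_isItoIntegral_comp hW hWc hφ hmap hWφ
      (g := fun V => ((latticeLangevinDynamics (fundamentalLatticeRep 2) β).noise
        (matrixConfig (fundamentalRep (Fin 2)) V) e n i j).im)
      (Complex.continuous_im.comp (continuous_noise_entry β e n i j)) (e, n) hUc.adapted hUc.continuous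
      (hJc e n i j).2
  choose Jr hJr hJreq using hre
  choose Ji hJi hJieq using him
  refine ⟨fun t => ?_, hcont, ⟨fun e n i j t ω => ((Jr e n i j t ω : ℝ) : ℂ) + ((Ji e n i j t ω : ℝ) : ℂ) * Complex.I,
    fun e n i j => ?_, ?_⟩⟩
  · -- adapted
    have hφ' : Measurable[(hWc.natFiltration t).comap φ, hWc.natFiltration t] φ := measurable_iff_comap_le.2 le_rfl
    exact ((hUc.adapted t).comp hφ').mono (h𝓕 t) le_rfl
  · -- the Itô integrals, real and imaginary parts
    refine ⟨?_, ?_⟩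
    · have h1 : (fun (t : ℝ≥0) ω => ((((Jr e n i j t ω : ℝ) : ℂ) + ((Ji e n i j t ω : ℝ) : ℂ) * Complex.I)).re) =
          Jr e n i j := by
        funext t ω; simp
      rw [h1]; exact hJr e n i j
    · have h1 : (fun (t : ℝ≥0) ω => ((((Jr e n i j t ω : ℝ) : ℂ) + ((Ji e n i j t ω : ℝ) : ℂ) * Complex.I)).im) =
          Ji e n i j := by
        funext t ω; simp
      rw [h1]; exact hJi e n i j
  · -- the integral equations, transported and with the integrals identified
    have h1 := hUceq
    rw [← hmap] at h1
    have heq := ae_of_ae_map hφ.aemeasurable h1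
    have hJall : ∀ᵐ ω ∂P, ∀ e n i j t, Jr e n i j t ω = (Jc e n i j t (φ ω)).re ∧
        Ji e n i j t ω = (Jc e n i j t (φ ω)).im := by
      have h1 : ∀ e n i j, ∀ᵐ ω ∂P, ∀ t, Jr e n i j t ω = (Jc e n i j t (φ ω)).re ∧
          Ji e n i j t ω = (Jc e n i j t (φ ω)).im := fun e n i j => by
        filter_upwards [hJreq e n i j, hJieq e n i j] with ω h1 h2 t
        exact ⟨h1 t, h2 t⟩
      have h2 := ae_all_iff.2 fun e => ae_all_iff.2 fun n => ae_all_iff.2 fun i => ae_all_iff.2 fun j => h1 e n i j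
      exact h2.mono fun ω hω e n i j t => hω e n i j t
    filter_upwards [heq, hJall] with ω hω hJω t e i j
    rw [hω t e i j]
    congr 1
    refine Finset.sum_congr rfl fun n _ => ?_
    apply Complex.ext
    · simp [(hJω e n i j t).1]
    · simp [(hJω e n i j t).2]

end Flat

end Summit.QuantumFields.YangMills.Theorems.ColdStartUniversality

end
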